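import Mathlib
import Summits.NavierStokesRegularity.FluidComputer.AbcClassIComplexBasesPrep
import Summits.NavierStokesRegularity.FluidComputer.AbcClassIIComplexBasesTransfer

/-!
# GROUP-B END-TO-END ON THE MODEL, CLASS I — ARBITRARY COMPLEX (UNITARY) ORBIT BASES (prep 3):
# transfer of coordinate eigenvectors through a per-orbit UNITARY change of basis, both ways
(profile-cert-3 g9, cell `ns-blowup`, 2026-08-27; the class-I twin of the cert-3 g8 class-II file of the same name — same statements and proofs over the class-I layer `AbcClassI*`)

HONEST FRAMING (human rulings D-0035/D-0074): nothing here is a claim about Navier–Stokes blow-up.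
WHAT THIS IS NOT: not NS evidence. MODEL lane (NS linearised about the forced ABC flow `abcFlow 1 1 1`,
class I); no certificate, number or census word moves. Sequel of `AbcClassIIComplexBasesPrep`.
* `coord_transfer_unitary` — the ALGEBRA, once: two banded "first-order matrices" `A`, `B` on `Idx` related
  by a per-orbit unitary `V` (`B i j = Σ conj(V a i.2) V a' j.2 A ⟨O_i,a⟩ ⟨O_j,a'⟩`, rows and columns of each
  `V_O` orthonormal): a coordinate vector `w'` solving `−(|O_i|²/R) w'_i + Σ_{j ∈ nbrIdx i} B_ij w'_j = λ w'_i`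
  gives `w ⟨O,a⟩ := Σ_b V_O a b · w' ⟨O,b⟩` solving the same equation for `A`, with EQUAL weighted square sums
  on every cube and `w ≠ 0` if `w' ≠ 0` (cert-3 g7's `coord_transfer` with the orthogonal `M` replaced by a
  unitary `V`; the saturated band `nbrIdx` and the cubes decompose orbitwise).
* `camc_inv` — the inverse relation `amat = U amc Uᴴ` orbitwise for the complex first-order matrix `amc`
  of a complex orthonormal orbit-basis family `wf` (`U` of `AbcClassIIComplexBasesPrep`).
* `ccoord_transfer` (amc-coordinates → amat-coordinates, `V = U`) and `ccoord_transfer_back`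
  (amat-coordinates → amc-coordinates, `V = Uᴴ`) — the two instantiations the end-to-end theorem uses
  (synthesis through instab4's `bfam`; REALITY via conjugation in the real basis and isolation).
Mathlib + the file named; no new definitions. bears_on LADDER-NS N5 / Z4-a(1). [folklore].
-/

noncomputable section

open scoped BigOperators ComplexConjugate InnerProductSpace Matrix
open Finset Matrix

namespace Summit.NavierStokesRegularity.FluidComputer.AbcClassIEigenpair

open Literature.Analysis.FunctionSpaces Literature.Analysis.FunctionSpaces.Torus
open Literature.Analysis.FunctionSpaces.EuclideanSpace
open Literature.Analysis.FluidPDE Literature.Analysis.FluidPDE.SteadyLattice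
open Summit.NavierStokesRegularity.FluidComputer.AbcClassI
open Summit.NavierStokesRegularity.FluidComputer.AbcClassII (Fam crossForm secOp rotR rotS sgnOrbit cube extend
  restrictTo Orbit toOrbit onormSq osupNorm cubeOrbits nbrOrbits mem_nbrOrbits mem_nbrOrbits_comm toOrbit_eq_iff
  mem_cubeOrbits onormSq_nonneg neg_mem_of_orbitClosed inner_eq_sum_extend extend_apply_of_mem
  extend_apply_of_not_mem sq_osupNorm_le_onormSq kdot_cut sum_cube_filter_eq mem_sgnOrbit_self)

/-! ### §1 The algebra of a per-orbit unitary coordinate change -/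

/-- Orbit-saturated index sets decompose orbitwise: a double sum `Σ_{j ∈ T} Σ_x Φ O_j x j.2` may swap
the two basis indices. -/
theorem sum_sigma_swap {T : Finset AbcClassI.Idx} (hT : ∀ i ∈ T, ∀ x : Fin (AbcClassI.odim i.1), (⟨i.1, x⟩ : AbcClassI.Idx) ∈ T)
    (Φ : (O : Orbit) → Fin (AbcClassI.odim O) → Fin (AbcClassI.odim O) → ℂ) :
    ∑ j ∈ T, ∑ x : Fin (AbcClassI.odim j.1), Φ j.1 x j.2 = ∑ j ∈ T, ∑ x : Fin (AbcClassI.odim j.1), Φ j.1 j.2 x := by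
  classical
  rw [← Finset.sum_sigma T (fun j : Idx => (Finset.univ : Finset (Fin (odim j.1))))
      (fun p => Φ p.1.1 p.2 p.1.2),
    ← Finset.sum_sigma T (fun j : Idx => (Finset.univ : Finset (Fin (odim j.1))))
      (fun p => Φ p.1.1 p.1.2 p.2)]
  refine Finset.sum_bij' (fun p _ => ⟨(⟨p.1.1, p.2⟩ : Idx), p.1.2⟩)
    (fun p _ => ⟨(⟨p.1.1, p.2⟩ : Idx), p.1.2⟩) ?_ ?_ ?_ ?_ ?_
  · intro p hp
    exact Finset.mem_sigma.mpr ⟨hT p.1 (Finset.mem_sigma.mp hp).1 p.2, Finset.mem_univ _⟩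
  · intro p hp
    exact Finset.mem_sigma.mpr ⟨hT p.1 (Finset.mem_sigma.mp hp).1 p.2, Finset.mem_univ _⟩
  · intro p _; rfl
  · intro p _; rfl
  · intro p _; rfl

/-- **Coordinate transfer through a per-orbit unitary change of basis.** -/
theorem coord_transfer_unitary {R : ℝ} (A B : AbcClassI.Idx → AbcClassI.Idx → ℂ)
    (V : (O : Orbit) → Fin (AbcClassI.odim O) → Fin (AbcClassI.odim O) → ℂ)
    (hrows : ∀ (O : Orbit) (a a' : Fin (AbcClassI.odim O)),
      ∑ b : Fin (AbcClassI.odim O), V O a b * conj (V O a' b) = if a = a' then 1 else 0)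
    (hcols : ∀ (O : Orbit) (b b' : Fin (AbcClassI.odim O)),
      ∑ a : Fin (AbcClassI.odim O), conj (V O a b) * V O a b' = if b = b' then 1 else 0)
    (hAB : ∀ i j : AbcClassI.Idx, B i j = ∑ a : Fin (AbcClassI.odim i.1), ∑ a' : Fin (AbcClassI.odim j.1),
      conj (V i.1 a i.2) * V j.1 a' j.2 * A ⟨i.1, a⟩ ⟨j.1, a'⟩)
    (lam : ℂ) (w' : AbcClassI.Idx → ℂ)
    (hE : ∀ i : AbcClassI.Idx, ((-(onormSq i.1 / R) : ℝ) : ℂ) * w' i + ∑ j ∈ AbcClassI.nbrIdx i, B i j * w' j = lam * w' i) :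
    ∃ w : AbcClassI.Idx → ℂ,
      (∀ (O : Orbit) (a : Fin (AbcClassI.odim O)), w ⟨O, a⟩ = ∑ b : Fin (AbcClassI.odim O), V O a b * w' ⟨O, b⟩) ∧
      (∀ i : AbcClassI.Idx, ((-(onormSq i.1 / R) : ℝ) : ℂ) * w i + ∑ j ∈ AbcClassI.nbrIdx i, A i j * w j = lam * w i) ∧
      (∀ (n : ℕ) (g : Orbit → ℝ), ∑ i ∈ AbcClassI.cubeIdx n, g i.1 * ‖w i‖ ^ 2 =
        ∑ i ∈ AbcClassI.cubeIdx n, g i.1 * ‖w' i‖ ^ 2) ∧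
      (w' ≠ 0 → w ≠ 0) := by
  classical
  set w : Idx → ℂ := fun i => ∑ b : Fin (odim i.1), V i.1 i.2 b * w' ⟨i.1, b⟩ with hw
  have hwO : ∀ (O : Orbit) (a : Fin (odim O)), w ⟨O, a⟩ = ∑ b : Fin (odim O), V O a b * w' ⟨O, b⟩ :=
    fun O a => rfl
  -- inverse transfer on one orbit: `Σ_a conj(V a b) · w ⟨O,a⟩ = w' ⟨O,b⟩`
  have hinv : ∀ (O : Orbit) (b : Fin (odim O)),
      ∑ a : Fin (odim O), conj (V O a b) * w ⟨O, a⟩ = w' ⟨O, b⟩ := by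
    intro O b
    calc ∑ a : Fin (odim O), conj (V O a b) * w ⟨O, a⟩
        = ∑ a : Fin (odim O), ∑ b' : Fin (odim O), conj (V O a b) * V O a b' * w' ⟨O, b'⟩ := by
          refine Finset.sum_congr rfl fun a _ => ?_
          rw [hwO, Finset.mul_sum]
          exact Finset.sum_congr rfl fun b' _ => by ring
      _ = ∑ b' : Fin (odim O), (∑ a : Fin (odim O), conj (V O a b) * V O a b') * w' ⟨O, b'⟩ := by
          rw [Finset.sum_comm]
          exact Finset.sum_congr rfl fun b' _ => by rw [Finset.sum_mul]
      _ = w' ⟨O, b⟩ := by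
          rw [Finset.sum_eq_single b (fun b' _ hb' => by rw [hcols, if_neg (Ne.symm hb'), zero_mul])
            (fun h => absurd (Finset.mem_univ b) h), hcols, if_pos rfl, one_mul]
  have hnbr_sat : ∀ (i : Idx), ∀ j ∈ nbrIdx i, ∀ x : Fin (odim j.1), (⟨j.1, x⟩ : Idx) ∈ nbrIdx i :=
    fun i j hj x => (mem_nbrIdx (i := i) (j := (⟨j.1, x⟩ : Idx))).mpr ((mem_nbrIdx (i := i) (j := j)).mp hj)
  have hcube_sat : ∀ n : ℕ, ∀ j ∈ cubeIdx n, ∀ x : Fin (odim j.1), (⟨j.1, x⟩ : Idx) ∈ cubeIdx n :=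
    fun n j hj x => cubeIdx_saturated n hj x
  refine ⟨w, hwO, fun i => ?_, fun n g => ?_, fun hne h0 => hne ?_⟩
  · -- the eigen-equation at `i = ⟨O, a⟩`
    obtain ⟨O, a⟩ := i
    -- (2) sum the `B`-equations of the orbit against the row `V a ·`
    have h2 : ((-(onormSq O / R) : ℝ) : ℂ) * w ⟨O, a⟩ +
        ∑ b : Fin (odim O), V O a b * ∑ j ∈ nbrIdx (⟨O, a⟩ : Idx), B ⟨O, b⟩ j * w' j =
        lam * w ⟨O, a⟩ := by
      have hb : ∀ b : Fin (odim O), V O a b * (((-(onormSq O / R) : ℝ) : ℂ) * w' ⟨O, b⟩) +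
          V O a b * ∑ j ∈ nbrIdx (⟨O, a⟩ : Idx), B ⟨O, b⟩ j * w' j = V O a b * (lam * w' ⟨O, b⟩) :=
        fun b => by rw [← mul_add]; exact congrArg _ (hE ⟨O, b⟩)
      have hs := Finset.sum_congr rfl fun b (_ : b ∈ (Finset.univ : Finset (Fin (odim O)))) => hb b
      rw [Finset.sum_add_distrib] at hs
      rw [hwO, Finset.mul_sum, Finset.mul_sum]
      calc ∑ b, ((-(onormSq O / R) : ℝ) : ℂ) * (V O a b * w' ⟨O, b⟩) +
            ∑ b, V O a b * ∑ j ∈ nbrIdx (⟨O, a⟩ : Idx), B ⟨O, b⟩ j * w' j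
          = ∑ b, V O a b * (((-(onormSq O / R) : ℝ) : ℂ) * w' ⟨O, b⟩) +
            ∑ b, V O a b * ∑ j ∈ nbrIdx (⟨O, a⟩ : Idx), B ⟨O, b⟩ j * w' j := by
            congr 1; exact Finset.sum_congr rfl fun b _ => by ring
        _ = ∑ b, V O a b * (lam * w' ⟨O, b⟩) := hs
        _ = ∑ b, lam * (V O a b * w' ⟨O, b⟩) := Finset.sum_congr rfl fun b _ => by ring
    -- (3) the first-order sums agree
    have h3 : ∑ b : Fin (odim O), V O a b * ∑ j ∈ nbrIdx (⟨O, a⟩ : Idx), B ⟨O, b⟩ j * w' j =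
        ∑ j ∈ nbrIdx (⟨O, a⟩ : Idx), A ⟨O, a⟩ j * w j := by
      have hexp : ∀ (b : Fin (odim O)) (j : Idx), B ⟨O, b⟩ j =
          ∑ a₁ : Fin (odim O), ∑ a' : Fin (odim j.1), conj (V O a₁ b) * V j.1 a' j.2 *
            A ⟨O, a₁⟩ ⟨j.1, a'⟩ := fun b j => hAB ⟨O, b⟩ j
      -- LHS: move the `b`-sum inside and use row orthonormality
      have hL : ∑ b : Fin (odim O), V O a b * ∑ j ∈ nbrIdx (⟨O, a⟩ : Idx), B ⟨O, b⟩ j * w' j =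
          ∑ j ∈ nbrIdx (⟨O, a⟩ : Idx), ∑ a' : Fin (odim j.1), V j.1 a' j.2 * A ⟨O, a⟩ ⟨j.1, a'⟩ * w' j := by
        calc ∑ b : Fin (odim O), V O a b * ∑ j ∈ nbrIdx (⟨O, a⟩ : Idx), B ⟨O, b⟩ j * w' j
            = ∑ b : Fin (odim O), ∑ j ∈ nbrIdx (⟨O, a⟩ : Idx), ∑ a₁ : Fin (odim O), ∑ a' : Fin (odim j.1),
                V O a b * conj (V O a₁ b) * (V j.1 a' j.2 * A ⟨O, a₁⟩ ⟨j.1, a'⟩ * w' j) := by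
              refine Finset.sum_congr rfl fun b _ => ?_
              rw [Finset.mul_sum]
              refine Finset.sum_congr rfl fun j _ => ?_
              rw [hexp b j, Finset.sum_mul, Finset.mul_sum]
              refine Finset.sum_congr rfl fun a₁ _ => ?_
              rw [Finset.sum_mul, Finset.mul_sum]
              exact Finset.sum_congr rfl fun a' _ => by ring
          _ = ∑ j ∈ nbrIdx (⟨O, a⟩ : Idx), ∑ a₁ : Fin (odim O), ∑ a' : Fin (odim j.1),
                (∑ b : Fin (odim O), V O a b * conj (V O a₁ b)) *
                  (V j.1 a' j.2 * A ⟨O, a₁⟩ ⟨j.1, a'⟩ * w' j) := by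
              rw [Finset.sum_comm]
              refine Finset.sum_congr rfl fun j _ => ?_
              rw [Finset.sum_comm]
              refine Finset.sum_congr rfl fun a₁ _ => ?_
              rw [Finset.sum_comm]
              refine Finset.sum_congr rfl fun a' _ => ?_
              rw [Finset.sum_mul]
          _ = ∑ j ∈ nbrIdx (⟨O, a⟩ : Idx), ∑ a' : Fin (odim j.1),
                V j.1 a' j.2 * A ⟨O, a⟩ ⟨j.1, a'⟩ * w' j := by
              refine Finset.sum_congr rfl fun j _ => ?_
              rw [Finset.sum_eq_single a (fun a₁ _ hne => by
                  rw [hrows, if_neg (Ne.symm hne)]; simp) (fun h => absurd (Finset.mem_univ a) h),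
                hrows, if_pos rfl]
              exact Finset.sum_congr rfl fun a' _ => by ring
      -- swap the two inner indices on the saturated set `nbrIdx ⟨O, a⟩`
      have hS := sum_sigma_swap (hnbr_sat ⟨O, a⟩) (fun O' x y => A ⟨O, a⟩ ⟨O', x⟩ * V O' x y * w' ⟨O', y⟩)
      rw [hL]
      calc ∑ j ∈ nbrIdx (⟨O, a⟩ : Idx), ∑ a' : Fin (odim j.1), V j.1 a' j.2 * A ⟨O, a⟩ ⟨j.1, a'⟩ * w' j
          = ∑ j ∈ nbrIdx (⟨O, a⟩ : Idx), ∑ x : Fin (odim j.1),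
              A ⟨O, a⟩ ⟨j.1, x⟩ * V j.1 x j.2 * w' ⟨j.1, j.2⟩ := by
            refine Finset.sum_congr rfl fun j _ => ?_
            obtain ⟨O', y⟩ := j
            exact Finset.sum_congr rfl fun x _ => by ring
        _ = ∑ j ∈ nbrIdx (⟨O, a⟩ : Idx), ∑ x : Fin (odim j.1),
              A ⟨O, a⟩ ⟨j.1, j.2⟩ * V j.1 j.2 x * w' ⟨j.1, x⟩ := hS
        _ = ∑ j ∈ nbrIdx (⟨O, a⟩ : Idx), A ⟨O, a⟩ j * w j := by
            refine Finset.sum_congr rfl fun j _ => ?_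
            obtain ⟨O', y⟩ := j
            rw [hwO O' y, Finset.mul_sum]
            exact Finset.sum_congr rfl fun x _ => by ring
    have goal : ((-(onormSq O / R) : ℝ) : ℂ) * w ⟨O, a⟩ +
        ∑ j ∈ nbrIdx (⟨O, a⟩ : Idx), A ⟨O, a⟩ j * w j = lam * w ⟨O, a⟩ := by
      rw [← h3]; exact h2
    exact goal
  · -- weighted square sums on cubes (complexify, expand, swap, collapse by column orthonormality)
    have hc : ((∑ i ∈ cubeIdx n, g i.1 * ‖w i‖ ^ 2 : ℝ) : ℂ) =
        ((∑ i ∈ cubeIdx n, g i.1 * ‖w' i‖ ^ 2 : ℝ) : ℂ) := by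
      push_cast
      have hsq : ∀ z : ℂ, ((‖z‖ : ℂ)) ^ 2 = conj z * z := fun z => by
        rw [mul_comm, Complex.mul_conj, Complex.normSq_eq_norm_sq]; push_cast; ring
      simp_rw [hsq]
      have hS := sum_sigma_swap (hcube_sat n) (fun O b a => ((g O : ℝ) : ℂ) *
        ∑ b' : Fin (odim O), conj (V O a b) * V O a b' * (conj (w' ⟨O, b⟩) * w' ⟨O, b'⟩))
      calc ∑ i ∈ cubeIdx n, ((g i.1 : ℝ) : ℂ) * (conj (w i) * w i)
          = ∑ i ∈ cubeIdx n, ∑ b : Fin (odim i.1), ((g i.1 : ℝ) : ℂ) *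
              ∑ b' : Fin (odim i.1), conj (V i.1 i.2 b) * V i.1 i.2 b' *
                (conj (w' ⟨i.1, b⟩) * w' ⟨i.1, b'⟩) := by
            refine Finset.sum_congr rfl fun i _ => ?_
            rw [← Finset.mul_sum]
            congr 1
            rw [hwO i.1 i.2, map_sum, Finset.sum_mul]
            refine Finset.sum_congr rfl fun b _ => ?_
            rw [Finset.mul_sum]
            refine Finset.sum_congr rfl fun b' _ => ?_
            rw [map_mul]
            ring
        _ = ∑ i ∈ cubeIdx n, ∑ x : Fin (odim i.1), ((g i.1 : ℝ) : ℂ) *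
              ∑ b' : Fin (odim i.1), conj (V i.1 x i.2) * V i.1 x b' *
                (conj (w' ⟨i.1, i.2⟩) * w' ⟨i.1, b'⟩) := hS
        _ = ∑ i ∈ cubeIdx n, ((g i.1 : ℝ) : ℂ) * (conj (w' i) * w' i) := by
            refine Finset.sum_congr rfl fun i _ => ?_
            obtain ⟨O', y⟩ := i
            rw [← Finset.mul_sum]
            congr 1
            calc ∑ x : Fin (odim O'), ∑ b' : Fin (odim O'), conj (V O' x y) * V O' x b' *
                  (conj (w' ⟨O', y⟩) * w' ⟨O', b'⟩)
                = ∑ b' : Fin (odim O'), (∑ x : Fin (odim O'), conj (V O' x y) * V O' x b') *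
                    (conj (w' ⟨O', y⟩) * w' ⟨O', b'⟩) := by
                  rw [Finset.sum_comm]
                  exact Finset.sum_congr rfl fun b' _ => by rw [Finset.sum_mul]
              _ = conj (w' ⟨O', y⟩) * w' ⟨O', y⟩ := by
                  rw [Finset.sum_eq_single y (fun b' _ hne => by
                      rw [hcols, if_neg (Ne.symm hne), zero_mul])
                    (fun h => absurd (Finset.mem_univ _) h), hcols, if_pos rfl, one_mul]
    exact_mod_cast hc
  · -- non-vanishing: `w = 0 ⇒ w' = 0`
    funext j
    obtain ⟨O, b⟩ := j
    rw [← hinv O b]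
    refine Finset.sum_eq_zero fun a _ => ?_
    rw [show w ⟨O, a⟩ = 0 from congrFun h0 ⟨O, a⟩, mul_zero]

/-! ### §2 The two instantiations for a complex orthonormal orbit-basis family -/

section ComplexBasesTransfer

variable (wf : Idx → Fam)
variable (hws : ∀ i : Idx, ∀ k ∉ i.1.1, wf i k = 0)
variable (hwt : ∀ (i : Idx) (k : Fin 3 → ℤ), ∑ j : Fin 3, ((k j : ℤ) : ℂ) * wf i k j = 0)
variable (hwI : ∀ i : Idx, IsClassI (wf i))
variable (hwon : ∀ (O : Orbit) (a b : Fin (odim O)),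
  ∑ k ∈ O.1, (inner ℂ (wf ⟨O, a⟩ k) (wf ⟨O, b⟩ k) : ℂ) = if a = b then 1 else 0)
variable (amc : Idx → Idx → ℂ)
variable (hamc : ∀ i j : Idx, amc i j =
  ∑ k ∈ i.1.1, (inner ℂ (wf i k) (Torus.lerayCoeff k (crossForm 1 1 1 (wf j) k)) : ℂ))

include hws hwt hwI hwon hamc

/-- **`amat = U amc Uᴴ` orbitwise** (the inverse of `camc_eq`):
`amat i j = Σ_{a a'} U_{O_i} i.2 a · conj(U_{O_j} j.2 a') · amc ⟨O_i,a⟩ ⟨O_j,a'⟩`. -/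
theorem camc_inv (i j : AbcClassI.Idx) :
    ((AbcClassI.amat i j : ℝ) : ℂ) = ∑ a : Fin (AbcClassI.odim i.1), ∑ a' : Fin (AbcClassI.odim j.1),
      (∑ k ∈ i.1.1, (inner ℂ (AbcClassI.bfam ⟨i.1, i.2⟩ k) (wf ⟨i.1, a⟩ k) : ℂ)) *
        conj (∑ k ∈ j.1.1, (inner ℂ (AbcClassI.bfam ⟨j.1, j.2⟩ k) (wf ⟨j.1, a'⟩ k) : ℂ)) *
          amc ⟨i.1, a⟩ ⟨j.1, a'⟩ := by
  obtain ⟨O, b⟩ := i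
  obtain ⟨O', b'⟩ := j
  set U : Fin (odim O) → Fin (odim O) → ℂ := fun c a =>
    ∑ k ∈ O.1, (inner ℂ (bfam ⟨O, c⟩ k) (wf ⟨O, a⟩ k) : ℂ) with hU
  set U' : Fin (odim O') → Fin (odim O') → ℂ := fun c' a' =>
    ∑ k ∈ O'.1, (inner ℂ (bfam ⟨O', c'⟩ k) (wf ⟨O', a'⟩ k) : ℂ) with hU'
  change ((amat ⟨O, b⟩ ⟨O', b'⟩ : ℝ) : ℂ) =
    ∑ a : Fin (odim O), ∑ a' : Fin (odim O'), U b a * conj (U' b' a') * amc ⟨O, a⟩ ⟨O', a'⟩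
  have hexp : ∀ (a : Fin (odim O)) (a' : Fin (odim O')), amc ⟨O, a⟩ ⟨O', a'⟩ =
      ∑ c : Fin (odim O), ∑ c' : Fin (odim O'), conj (U c a) * U' c' a' * ((amat ⟨O, c⟩ ⟨O', c'⟩ : ℝ) : ℂ) :=
    fun a a' => camc_eq wf hws hwt hwI amc hamc ⟨O, a⟩ ⟨O', a'⟩
  have hrows : ∀ a a' : Fin (odim O), ∑ c : Fin (odim O), U a c * conj (U a' c) = if a = a' then 1 else 0 :=
    fun a a' => cU_orth_rows wf hws hwt hwI hwon O a a'
  have hrows' : ∀ c c' : Fin (odim O'), ∑ a' : Fin (odim O'), conj (U' c a') * U' c' a' =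
      if c = c' then 1 else 0 := by
    intro c c'
    have h : ∑ a' : Fin (odim O'), U' c a' * conj (U' c' a') = if c = c' then 1 else 0 :=
      cU_orth_rows wf hws hwt hwI hwon O' c c'
    have h' := congrArg conj h
    rw [map_sum] at h'
    have e : conj (if c = c' then (1 : ℂ) else 0) = if c = c' then (1 : ℂ) else 0 := by
      split_ifs <;> simp
    rw [e] at h'
    refine Eq.trans (Finset.sum_congr rfl fun a' _ => ?_) h'
    rw [map_mul, Complex.conj_conj]
  clear_value U U'
  symm
  calc ∑ a : Fin (odim O), ∑ a' : Fin (odim O'), U b a * conj (U' b' a') * amc ⟨O, a⟩ ⟨O', a'⟩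
      = ∑ a : Fin (odim O), ∑ a' : Fin (odim O'), ∑ c : Fin (odim O), ∑ c' : Fin (odim O'),
          (U b a * conj (U c a)) * (conj (U' b' a') * U' c' a') * ((amat ⟨O, c⟩ ⟨O', c'⟩ : ℝ) : ℂ) := by
        refine Finset.sum_congr rfl fun a _ => Finset.sum_congr rfl fun a' _ => ?_
        rw [hexp a a', Finset.mul_sum]
        refine Finset.sum_congr rfl fun c _ => ?_
        rw [Finset.mul_sum]
        exact Finset.sum_congr rfl fun c' _ => by ring
    _ = ∑ a : Fin (odim O), ∑ c : Fin (odim O), ∑ a' : Fin (odim O'), ∑ c' : Fin (odim O'),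
          (U b a * conj (U c a)) * (conj (U' b' a') * U' c' a') * ((amat ⟨O, c⟩ ⟨O', c'⟩ : ℝ) : ℂ) := by
        refine Finset.sum_congr rfl fun a _ => ?_
        rw [Finset.sum_comm]
    _ = ∑ c : Fin (odim O), ∑ a : Fin (odim O), ∑ a' : Fin (odim O'), ∑ c' : Fin (odim O'),
          (U b a * conj (U c a)) * (conj (U' b' a') * U' c' a') * ((amat ⟨O, c⟩ ⟨O', c'⟩ : ℝ) : ℂ) := by
        rw [Finset.sum_comm]
    _ = ∑ c : Fin (odim O), ∑ a : Fin (odim O), ∑ c' : Fin (odim O'), ∑ a' : Fin (odim O'),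
          (U b a * conj (U c a)) * (conj (U' b' a') * U' c' a') * ((amat ⟨O, c⟩ ⟨O', c'⟩ : ℝ) : ℂ) := by
        refine Finset.sum_congr rfl fun c _ => Finset.sum_congr rfl fun a _ => ?_
        rw [Finset.sum_comm]
    _ = ∑ c : Fin (odim O), ∑ c' : Fin (odim O'), ∑ a : Fin (odim O), ∑ a' : Fin (odim O'),
          (U b a * conj (U c a)) * (conj (U' b' a') * U' c' a') * ((amat ⟨O, c⟩ ⟨O', c'⟩ : ℝ) : ℂ) := by
        refine Finset.sum_congr rfl fun c _ => ?_
        rw [Finset.sum_comm]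
    _ = ∑ c : Fin (odim O), ∑ c' : Fin (odim O'),
          (∑ a : Fin (odim O), U b a * conj (U c a)) * (∑ a' : Fin (odim O'), conj (U' b' a') * U' c' a') *
            ((amat ⟨O, c⟩ ⟨O', c'⟩ : ℝ) : ℂ) := by
        refine Finset.sum_congr rfl fun c _ => Finset.sum_congr rfl fun c' _ => ?_
        rw [Finset.sum_mul_sum, Finset.sum_mul]
        refine Finset.sum_congr rfl fun a _ => ?_
        rw [Finset.sum_mul]
    _ = ((amat ⟨O, b⟩ ⟨O', b'⟩ : ℝ) : ℂ) := by
        rw [Finset.sum_eq_single b (fun c _ hne => by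
            rw [hrows b c, if_neg (Ne.symm hne)]
            exact Finset.sum_eq_zero fun c' _ => by rw [zero_mul, zero_mul])
          (fun h => absurd (Finset.mem_univ b) h), hrows b b, if_pos rfl]
        rw [Finset.sum_eq_single b' (fun c' _ hne => by rw [hrows' b' c', if_neg (Ne.symm hne)]; ring)
          (fun h => absurd (Finset.mem_univ b') h), hrows' b' b', if_pos rfl]
        ring

/-- **Forward transfer** (`amc`-coordinates → `amat`-coordinates). -/
theorem ccoord_transfer {R : ℝ} (lam : ℂ) (w' : AbcClassI.Idx → ℂ)
    (hE : ∀ i : AbcClassI.Idx, ((-(onormSq i.1 / R) : ℝ) : ℂ) * w' i + ∑ j ∈ AbcClassI.nbrIdx i, amc i j * w' j = lam * w' i) :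
    ∃ w : AbcClassI.Idx → ℂ,
      (∀ (O : Orbit) (a : Fin (AbcClassI.odim O)), w ⟨O, a⟩ = ∑ b : Fin (AbcClassI.odim O),
        (∑ k ∈ O.1, (inner ℂ (AbcClassI.bfam ⟨O, a⟩ k) (wf ⟨O, b⟩ k) : ℂ)) * w' ⟨O, b⟩) ∧
      (∀ i : AbcClassI.Idx, ((-(onormSq i.1 / R) : ℝ) : ℂ) * w i +
        ∑ j ∈ AbcClassI.nbrIdx i, ((AbcClassI.amat i j : ℝ) : ℂ) * w j = lam * w i) ∧
      (∀ (n : ℕ) (g : Orbit → ℝ), ∑ i ∈ AbcClassI.cubeIdx n, g i.1 * ‖w i‖ ^ 2 =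
        ∑ i ∈ AbcClassI.cubeIdx n, g i.1 * ‖w' i‖ ^ 2) ∧
      (w' ≠ 0 → w ≠ 0) :=
  coord_transfer_unitary (fun i j => ((amat i j : ℝ) : ℂ)) amc
    (fun O a b => ∑ k ∈ O.1, (inner ℂ (bfam ⟨O, a⟩ k) (wf ⟨O, b⟩ k) : ℂ))
    (cU_orth_rows wf hws hwt hwI hwon) (cU_orth_cols wf hws hwt hwI hwon)
    (camc_eq wf hws hwt hwI amc hamc) lam w' hE

/-- **Backward transfer** (`amat`-coordinates → `amc`-coordinates, through `Uᴴ`). -/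
theorem ccoord_transfer_back {R : ℝ} (lam : ℂ) (w' : AbcClassI.Idx → ℂ)
    (hE : ∀ i : AbcClassI.Idx, ((-(onormSq i.1 / R) : ℝ) : ℂ) * w' i +
      ∑ j ∈ AbcClassI.nbrIdx i, ((AbcClassI.amat i j : ℝ) : ℂ) * w' j = lam * w' i) :
    ∃ w : AbcClassI.Idx → ℂ,
      (∀ (O : Orbit) (a : Fin (AbcClassI.odim O)), w ⟨O, a⟩ = ∑ b : Fin (AbcClassI.odim O),
        conj (∑ k ∈ O.1, (inner ℂ (AbcClassI.bfam ⟨O, b⟩ k) (wf ⟨O, a⟩ k) : ℂ)) * w' ⟨O, b⟩) ∧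
      (∀ i : AbcClassI.Idx, ((-(onormSq i.1 / R) : ℝ) : ℂ) * w i + ∑ j ∈ AbcClassI.nbrIdx i, amc i j * w j = lam * w i) ∧
      (∀ (n : ℕ) (g : Orbit → ℝ), ∑ i ∈ AbcClassI.cubeIdx n, g i.1 * ‖w i‖ ^ 2 =
        ∑ i ∈ AbcClassI.cubeIdx n, g i.1 * ‖w' i‖ ^ 2) ∧
      (w' ≠ 0 → w ≠ 0) := by
  have hrows : ∀ (O : Orbit) (a a' : Fin (odim O)), ∑ b : Fin (odim O),
      conj (∑ k ∈ O.1, (inner ℂ (bfam ⟨O, b⟩ k) (wf ⟨O, a⟩ k) : ℂ)) *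
        conj (conj (∑ k ∈ O.1, (inner ℂ (bfam ⟨O, b⟩ k) (wf ⟨O, a'⟩ k) : ℂ))) =
      if a = a' then 1 else 0 := by
    intro O a a'
    rw [← cU_orth_cols wf hws hwt hwI hwon O a a']
    exact Finset.sum_congr rfl fun b _ => by rw [Complex.conj_conj]
  have hcols : ∀ (O : Orbit) (b b' : Fin (odim O)), ∑ a : Fin (odim O),
      conj (conj (∑ k ∈ O.1, (inner ℂ (bfam ⟨O, b⟩ k) (wf ⟨O, a⟩ k) : ℂ))) *
        conj (∑ k ∈ O.1, (inner ℂ (bfam ⟨O, b'⟩ k) (wf ⟨O, a⟩ k) : ℂ)) = if b = b' then 1 else 0 := by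
    intro O b b'
    rw [← cU_orth_rows wf hws hwt hwI hwon O b b']
    exact Finset.sum_congr rfl fun a _ => by rw [Complex.conj_conj]
  have hAB : ∀ i j : Idx, ((amat i j : ℝ) : ℂ) = ∑ a : Fin (odim i.1), ∑ a' : Fin (odim j.1),
      conj (conj (∑ k ∈ i.1.1, (inner ℂ (bfam ⟨i.1, i.2⟩ k) (wf ⟨i.1, a⟩ k) : ℂ))) *
        conj (∑ k ∈ j.1.1, (inner ℂ (bfam ⟨j.1, j.2⟩ k) (wf ⟨j.1, a'⟩ k) : ℂ)) *
          amc ⟨i.1, a⟩ ⟨j.1, a'⟩ := by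
    intro i j
    rw [camc_inv wf hws hwt hwI hwon amc hamc i j]
    exact Finset.sum_congr rfl fun a _ => Finset.sum_congr rfl fun a' _ => by rw [Complex.conj_conj]
  exact coord_transfer_unitary amc (fun i j => ((amat i j : ℝ) : ℂ))
    (fun O a b => conj (∑ k ∈ O.1, (inner ℂ (bfam ⟨O, b⟩ k) (wf ⟨O, a⟩ k) : ℂ)))
    hrows hcols hAB lam w' hE

end ComplexBasesTransfer

end Summit.NavierStokesRegularity.FluidComputer.AbcClassIEigenpair

end
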